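import Summits.ResolutionOfSingularities.ResolutionOfSingularities.Theorems.WallFrames13
import Summits.ResolutionOfSingularities.ResolutionOfSingularities.Theorems.NearCutCompanion3
import Summits.ResolutionOfSingularities.ResolutionOfSingularities.Theorems.NearCutWalls2
import Summits.ResolutionOfSingularities.ResolutionOfSingularities.Theorems.ProximityCutArcLaw
import Summits.ResolutionOfSingularities.ResolutionOfSingularities.Theorems.MaxContactCutBoundaryLedger
import Summits.ResolutionOfSingularities.ResolutionOfSingularities.Theorems.MaxContactCutWallCut
import Summits.ResolutionOfSingularities.ResolutionOfSingularities.Theorems.PlanarGhostDescent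
import Literature.AlgebraicGeometry.Resolution.PointBlowupIFPGiraud
import Literature.AlgebraicGeometry.Resolution.AdicNoetherian
import HarnessLib

/-!
# WallFrames (14/17) — Kollár's wall descent in a polynomial frame; sections: Steps (cont.), Chain

Verbatim slice of the farm-checked monolith `WallFrames.lean` of cell `decomp-res`, seat `decomp-res-lens-5`, g35
(sha256 7405a21d81d102a4…, monolith lines 3330–3463); one namespace `Summit.ResolutionOfSingularities.ResolutionOfSingularities.Theorems.WallFrames` across the
slices, imports chained.  The monolith's module docstring (laws W1–W7, mechanism, novelty, honest placement) is
reproduced in slice 1; the main theorem `balancedWallPort_holds : WallCut.BalancedWallPort` (hypothesis-free) and the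
host-route corollary `ecBalancedWallPort_holds` (aside item 27368 of route MaxContactCut) are in slice 16/17.
-/

open MvPolynomial Finset
open scoped BigOperators
open Literature.AlgebraicGeometry.Resolution
open Literature.AlgebraicGeometry.Resolution.Hauser2010
open Literature.AlgebraicGeometry.Resolution.PointBlowup
open Literature.AlgebraicGeometry.Resolution.HauserPerlega2024

namespace Summit.ResolutionOfSingularities.ResolutionOfSingularities.Theorems.WallFrames

variable {σ : Type*} [Fintype σ] [DecidableEq σ] {K : Type*} [Field K]

section Steps

omit [Fintype σ] [DecidableEq σ] in
/-- A monomial multiple `monomial m c · P` with `Λ + m_z ≤ |m|` is far. [folklore] -/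
theorem far_monomial_mul {z : σ} {Λ : ℕ} {m : σ →₀ ℕ} (hm : Λ + m z ≤ m.degree) (c : K) (P : MvPolynomial σ K) :
    ∀ d ∈ (monomial m c * P).support, Λ + d z ≤ d.degree := by
  classical
  rw [mul_comm]
  refine far_mul (fun d hd => ?_) P
  rw [support_monomial] at hd
  split_ifs at hd with hc
  · simp at hd
  · rw [Finset.mem_singleton] at hd; rw [hd]; exact hm

/-- **LOST-WALL PRESENTATION STEP.** [new] -/
theorem presentation_transport_step {z j : σ} (hjz : j ≠ z) {ζ : MvPolynomial σ K}
    (hζ : (∀ μ ∈ ζ.support, μ z = 0)) (hζ1 : (1 : ℕ∞) ≤ ordZero ζ)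
    {b : σ → K} (hb : ∀ i, i ≠ z → b i = 0) {s Λ : ℕ} (hsΛ : s ≤ Λ) {G : MvPolynomial σ K}
    (hG : (s : ℕ∞) ≤ ordZero G)
    {α : Type*} {A : Finset α} {ι : α → σ →₀ ℕ} {U : α → MvPolynomial σ K} {R : MvPolynomial σ K}
    (hι : ∀ a ∈ A, ∀ a' ∈ A, ι a = ι a' → a = a') (hU : ∀ a ∈ A, constantCoeff (U a) ≠ 0)
    (hR : ∀ d ∈ R.support, Λ + d z ≤ d.degree) (hpres : zshear z ζ G = ∑ a ∈ A, monomial (ι a) 1 * U a + R) :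
    (∀ a ∈ A, s ≤ (ι a).degree) ∧
    (∀ a ∈ A, ∀ a' ∈ A, chartExponent s j (ι a) = chartExponent s j (ι a') → a = a') ∧
    (∀ a ∈ A, constantCoeff (chartTransform 0 j (U a)) ≠ 0) ∧
    (∀ d ∈ (chartTransform s j R).support, (Λ - s) + d z ≤ d.degree) ∧
    zshear z (chartTransform 1 j ζ - C (b z)) (PointBlowup.translate b (chartTransform s j G)) =
      ∑ a ∈ A, monomial (chartExponent s j (ι a)) 1 * chartTransform 0 j (U a) + chartTransform s j R := by
  have hRs : ∀ d ∈ R.support, s ≤ d.degree := fun d hd => by have := hR d hd; omega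
  have hS : ∀ a ∈ A, s ≤ (ι a).degree :=
    degree_ge_of_mem_presentation A ι U R hι hU hRs (by rw [← hpres, ordZero_zshear hζ hζ1]; exact hG)
  refine ⟨hS, fun a ha a' ha' h => hι a ha a' ha' (chartExponent_injOn s j (hS a ha) (hS a' ha') h),
    fun a ha => by rw [constantCoeff_chartTransform_zero]; exact hU a ha,
    far_chartTransform hjz hsΛ hR, presentation_transport hjz hζ1 hb hG hS hpres⟩

/-- **FREE-CHART PRESENTATION STEP.** [new] -/
theorem presentation_freeChart_step {u v z : σ} (huv : u ≠ v) (huz : u ≠ z) (hvz : v ≠ z)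
    (hσ : ∀ i, i = u ∨ i = v ∨ i = z) {b : σ → K} {β : K} (hbv : b v = β) (hb : ∀ i, i ≠ v → b i = 0)
    (hβ : β ≠ 0) {ζ : MvPolynomial σ K} (hζ : (∀ μ ∈ ζ.support, μ z = 0)) (hζ1 : (1 : ℕ∞) ≤ ordZero ζ)
    {ζ₂ Qg rg : MvPolynomial σ K} (hζ₂ : (∀ μ ∈ ζ₂.support, μ v = 0)) (hζ₂1 : (1 : ℕ∞) ≤ ordZero ζ₂)
    (hrg : (∀ μ ∈ rg.support, μ v = 0)) (hQg : constantCoeff Qg ≠ 0)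
    (hg : PointBlowup.translate b (1 - chartTransform 1 z ζ) = Qg * (X v - ζ₂) + rg)
    {s Λ : ℕ} (hsΛ : s ≤ Λ) (hrgΛ : ((Λ - s : ℕ) : ℕ∞) ≤ ordZero rg)
    {G : MvPolynomial σ K} (hs : (s : ℕ∞) ≤ ordZero G)
    {α : Type*} {A : Finset α} {ι : α → σ →₀ ℕ} {U : α → MvPolynomial σ K} {R : MvPolynomial σ K}
    (hι : ∀ a ∈ A, ∀ a' ∈ A, ι a = ι a' → a = a') (hU : ∀ a ∈ A, constantCoeff (U a) ≠ 0)
    (hR : ∀ d ∈ R.support, Λ + d z ≤ d.degree) (hpres : zshear z ζ G = ∑ a ∈ A, monomial (ι a) 1 * U a + R) :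
    ∃ (U' : α → MvPolynomial σ K) (R' : MvPolynomial σ K),
      (∀ a ∈ A, s ≤ (ι a) u + (ι a) v + (ι a) z) ∧
      (∀ a ∈ A, ∀ a' ∈ A,
        Finsupp.single u ((ι a) u) + Finsupp.single z ((ι a) u + (ι a) v + (ι a) z - s) +
            Finsupp.single v ((ι a) z) =
          Finsupp.single u ((ι a') u) + Finsupp.single z ((ι a') u + (ι a') v + (ι a') z - s) +
            Finsupp.single v ((ι a') z) → a = a') ∧
      (∀ a ∈ A, constantCoeff (U' a) ≠ 0) ∧
      (∀ d ∈ R'.support, (Λ - s) + d v ≤ d.degree) ∧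
      zshear v ζ₂ (PointBlowup.translate b (chartTransform s z G)) =
        ∑ a ∈ A, monomial (Finsupp.single u ((ι a) u) + Finsupp.single z ((ι a) u + (ι a) v + (ι a) z - s) +
          Finsupp.single v ((ι a) z)) 1 * U' a + R' := by
  classical
  have hRs : ∀ d ∈ R.support, s ≤ d.degree := fun d hd => by have := hR d hd; omega
  have hS : ∀ a ∈ A, s ≤ (ι a).degree :=
    degree_ge_of_mem_presentation A ι U R hι hU hRs (by rw [← hpres, ordZero_zshear hζ hζ1]; exact hs)
  have hS3 : ∀ a ∈ A, s ≤ (ι a) u + (ι a) v + (ι a) z := fun a ha => by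
    rw [← degree_eq_of_three huv huz hvz hσ]; exact hS a ha
  have hE := presentation_freeChart huv huz hvz hσ hbv hb hζ hζ1 hζ₂ hrg hg hs hS hRs hpres
  set Q := zshear v ζ₂ Qg with hQdef
  have hQ0 : constantCoeff Q ≠ 0 := by rw [hQdef, constantCoeff_zshear hζ₂1]; exact hQg
  have hζ₂0 : constantCoeff ζ₂ = 0 := (one_le_ordZero_iff ζ₂).mp hζ₂1
  -- far-ness of `rg` and of everything in `(rg)`
  have hrgfar : ∀ d ∈ rg.support, (Λ - s) + d v ≤ d.degree := far_of_varFree hrg hrgΛ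
  set R' := ∑ a ∈ A, X u ^ (ι a) u * X z ^ ((ι a) u + (ι a) v + (ι a) z - s) *
          (rotSubst u v z β ζ₂ Q rg (U a) * (X v + C β + ζ₂) ^ (ι a) v *
            ((Q * X v + rg) ^ (ι a) z - (Q * X v) ^ (ι a) z))
      + ∑ d ∈ R.support, (X u ^ d u * X z ^ (d u + d v + d z - s) * X v ^ d z *
          (rotSubst u v z β ζ₂ Q rg (C (coeff d R)) * (X v + C β + ζ₂) ^ d v * Q ^ d z)
        + X u ^ d u * X z ^ (d u + d v + d z - s) *
          (rotSubst u v z β ζ₂ Q rg (C (coeff d R)) * (X v + C β + ζ₂) ^ d v *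
            ((Q * X v + rg) ^ d z - (Q * X v) ^ d z))) with hR'def
  refine ⟨fun a => rotSubst u v z β ζ₂ Q rg (U a) * (X v + C β + ζ₂) ^ (ι a) v * Q ^ (ι a) z, R', hS3,
    fun a ha a' ha' h => hι a ha a' ha' (rotIndex_injOn huv huz hvz hσ s (hS3 a ha) (hS3 a' ha') h),
    fun a ha => ?_, ?_, ?_⟩
  · rw [constantCoeff_freeChart_unit β hζ₂0]
    exact mul_ne_zero (mul_ne_zero (hU a ha) (pow_ne_zero _ hβ)) (pow_ne_zero _ hQ0)
  · rw [hR'def]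
    refine far_add (far_sum _ _ fun a ha => ?_) (far_sum _ _ fun d hd => far_add ?_ ?_)
    · refine far_of_mem_span hrgfar (Ideal.mul_mem_left _ _ (Ideal.mul_mem_left _ _ ?_))
      exact sub_pow_mem_span Q rg (X v) _
    · rw [X_pow_mul_eq_monomial]
      refine far_monomial_mul ?_ _ _
      have h1 := hR d hd
      rw [degree_eq_of_three huv huz hvz hσ d] at h1
      simp only [map_add, Finsupp.degree_single, Finsupp.add_apply, Finsupp.single_apply,
        if_neg huv, if_neg hvz.symm, if_true, zero_add]
      omega
    · refine far_of_mem_span hrgfar (Ideal.mul_mem_left _ _ (Ideal.mul_mem_left _ _ ?_))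
      exact sub_pow_mem_span Q rg (X v) _
  · rw [hE, hR'def, add_assoc]
    congr 1
    refine Finset.sum_congr rfl fun a ha => ?_
    rw [X_pow_mul_eq_monomial]

omit [Fintype σ] in
/-- **COEFFICIENT STABILITY** (NEXT-g36 §5): deepening the shear by a `z`-free `ε` of order `≥ Λ` does not change the
near coefficients (`|n| < Λ + n_z`). [new] -/
theorem coeff_zshear_stable {z : σ} {ζ ε : MvPolynomial σ K} (hζ : (∀ μ ∈ ζ.support, μ z = 0))
    (hε : (∀ μ ∈ ε.support, μ z = 0)) {Λ : ℕ} (hεΛ : ∀ d ∈ ε.support, Λ ≤ d.degree) (G : MvPolynomial σ K)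
    {n : σ →₀ ℕ} (hn : n.degree < Λ + n z) : coeff n (zshear z (ζ + ε) G) = coeff n (zshear z ζ G) := by
  classical
  obtain ⟨hP, -, hRfar⟩ := presentation_of_support z Λ (zshear z ζ G)
  obtain ⟨R', hR', hE⟩ := presentation_reshear hζ hε hεΛ hRfar hP
  have h1 : coeff n (∑ m ∈ (zshear z ζ G).support.filter (fun m => ¬ m.degree < Λ + m z),
      monomial m (coeff m (zshear z ζ G))) = 0 := by
    by_contra h
    have := hRfar n (mem_support_iff.mpr h)
    omega
  have h2 : coeff n R' = 0 := by
    by_contra h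
    have := hR' n (mem_support_iff.mpr h)
    omega
  rw [hE, coeff_add, h2]
  conv_rhs => rw [hP, coeff_add, h1]

end Steps

/-! ## §22 THE PRESENTATION CHAIN WITH ITS TORIC SHADOW (NEXT-g36 §4–§5, PROVED)

For a threshold budget `Λ₀` and an initial jet `ζ₀` of the lineage of depth `≥ Λ₀ + 1`, the initial unit-weighted
presentation of `zshear f₀ ζ₀ G_0` over an index set `A` is carried along the walk for every `τ` with `s τ ≤ Λ₀`:
frame `(f_τ, ζ_τ)` with `ζ_τ` a jet of `h_τ` of depth `≥ Λ₀ − sτ + 1`, labels `ι_τ : A → ℕ^3` injective, units, far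
remainder of threshold `Λ₀ − sτ`, and the TORIC LINK: the free exponent `(ι_τ a)(f_τ) = a(f_0)` is constant and the wall
exponents, shifted by the row `i(a) = s − a(f_0)`, are EXACTLY the toric orbit `ExtinctionCut.orbit w x₀(a) τ`. -/

section Chain

variable {L : Type} [Field L] [DecidableEq L]

end Chain

end Summit.ResolutionOfSingularities.ResolutionOfSingularities.Theorems.WallFrames
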